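import Mathlib
import HarnessLib
import Summits.NavierStokesRegularity.NavierStokesRegularity.Theorems.PoloidalWindowDoorPoloidalWindowRigidityFlat
import Summits.NavierStokesRegularity.NavierStokesRegularity.Theorems.PoloidalWindowDoorPoloidalWindowRigidityZShockClebschTransport

/-!
# Crux K2 `PoloidalWindowRigidity` (stmt-NavierStokesRegularity-19708), line `z_shock` — GLOBAL form of the (SF) bridge: an Aut-column
# class profile is either REGULAR (horizontally flat stratum) or a passive-scalar problem on an OPEN DENSE part of the backward slab

`--supports stmt-NavierStokesRegularity-19708 --as helper` (leafhand-ns-poloidalwindowdoor-3 g13, cell decomp-ns, 2026-08-31).  Def-free.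
**No stub and no summit is closed by this file; Navier–Stokes regularity is NOT proved here (rung 0).**

The local bridges B1–B3 (`…ZShockSlopeFunctionSpaceTime`, `…PressureLocal`, `…SourceLocal`, `…ZShockClebschTransport`) live off the
degenerate set `{∇ₕv₂ = 0}`.  For a class profile this set is analytic, so it is either the WHOLE slab — then `∂₀v₂ ≡ 0`, the settled
FLAT sub-stratum (`…Flat.stub_flatStratum`: regular, in fact `v ≡ 0`) — or its complement is OPEN AND DENSE in the slab (identity
theorem for the jointly analytic entry `∂₀v₂`, `…K2OfLrcSlope.analyticOnNhd_uncurry_fderiv_entry`, on the connected slab):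

* `entry_zero_or_dense_ne` — for a class profile and any entry `∂ⱼvᵢ`: either `∂ⱼvᵢ ≡ 0` on the slab, or every nonempty open subset
  of the slab contains a point with `∂ⱼvᵢ ≠ 0`;
* ★ `regular_or_dense_transport_of_class_autonomy` — class binders of `stub_zShockThickAut` + the stub's local autonomy clause on an
  open nonempty `W₁` of the slab ⟹ EITHER `¬ IsBackwardSingularPoint v 0`, OR the set `{∂₀v₂ ≠ 0}` meets every nonempty open subset of
  the slab and at EACH of its points the conclusion of `clebschWeight_transport_of_class_autonomy` holds (a `C^∞` slope antiderivative,
  a `(t, x₂)`-only source `A`, a space–time box with the (SF) constraint and `𝓛[v₂ − G(·,v₂)] = A(t, x₂)`).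

So the located residual B4 of the Aut column is a statement about a passive scalar defined on an open dense part of the slab (with
locally defined slope antiderivatives), not merely near one window point.  presearch: n/a (tree-internal). [folklore]
-/

noncomputable section

-- the summit and its single sub-problem share the name (CONVENTIONS §1), as in every Theorems file
set_option linter.dupNamespace false

namespace Summit.NavierStokesRegularity.NavierStokesRegularity.Theorems.PoloidalWindowDoorPoloidalWindowRigidityZShockSFDichotomy

open MeasureTheory Set Function Filter Topology TopologicalSpace Metric InnerProductSpace
open scoped RealInnerProductSpace InnerProductSpace Laplacian ContDiff
open Literature.Analysis Literature.Analysis.FluidPDE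
open Summit.NavierStokesRegularity.NavierStokesRegularity.Theorems.LocalSineTubeDoorProfileAlignedWindowRigidityAncient
open Summit.NavierStokesRegularity.NavierStokesRegularity.Theorems.PoloidalWindowDoorPoloidalWindowRigidityK2OfLrcSlope
open Summit.NavierStokesRegularity.NavierStokesRegularity.Theorems.PoloidalWindowDoorPoloidalWindowRigidityFlat
open Summit.NavierStokesRegularity.NavierStokesRegularity.Theorems.PoloidalWindowDoorPoloidalWindowRigidityZShockClebschTransport

variable {C : ℝ} {v : ℝ → EuclideanSpace ℝ (Fin 3) → EuclideanSpace ℝ (Fin 3)}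

/-- **An entry `∂ⱼvᵢ` of a class profile vanishes identically on the slab or is non-zero on a dense subset of it** (joint analyticity of
the entry on the open connected slab + identity theorem). [folklore] -/
theorem entry_zero_or_dense_ne (hrate : HasTypeITimeDecay C v)
    (hcont : ContinuousOn (uncurry v) (Iio (0 : ℝ) ×ˢ univ))
    (hmild : ∀ s t : ℝ, s < t → t < 0 → ∀ x,
      v t x = UnboundedOperators.heatExtension (v s) (t - s) x - oseenDuhamel 1 s v v t x)
    (j i : Fin 3) :
    (∀ t < 0, ∀ x : EuclideanSpace ℝ (Fin 3), fderiv ℝ (v t) x (EuclideanSpace.single j 1) i = 0) ∨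
    (∀ W' : Set (ℝ × EuclideanSpace ℝ (Fin 3)), IsOpen W' → W'.Nonempty → W' ⊆ Set.Iio (0 : ℝ) ×ˢ Set.univ →
      ∃ z ∈ W', fderiv ℝ (v z.1) z.2 (EuclideanSpace.single j 1) i ≠ 0) := by
  by_cases hflat : ∀ t < 0, ∀ x : EuclideanSpace ℝ (Fin 3), fderiv ℝ (v t) x (EuclideanSpace.single j 1) i = 0
  · exact Or.inl hflat
  · right
    push Not at hflat
    obtain ⟨t₀, ht₀, x₀, hx₀⟩ := hflat
    intro W' hW'o hW'ne hW's
    by_contra hall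
    push Not at hall
    obtain ⟨z₁, hz₁⟩ := hW'ne
    have han : AnalyticOnNhd ℝ (fun z : ℝ × EuclideanSpace ℝ (Fin 3) => fderiv ℝ (v z.1) z.2 (EuclideanSpace.single j 1) i)
        (Iio (0 : ℝ) ×ˢ univ) := analyticOnNhd_uncurry_fderiv_entry hrate hcont hmild j i
    have hpre : IsPreconnected (Set.Iio (0 : ℝ) ×ˢ (Set.univ : Set (EuclideanSpace ℝ (Fin 3)))) :=
      isPreconnected_Iio.prod isPreconnected_univ
    have hz : (fun z : ℝ × EuclideanSpace ℝ (Fin 3) => fderiv ℝ (v z.1) z.2 (EuclideanSpace.single j 1) i) =ᶠ[𝓝 z₁] 0 := by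
      filter_upwards [hW'o.mem_nhds hz₁] with z hz
      exact hall z hz
    have h := han.eqOn_zero_of_preconnected_of_eventuallyEq_zero hpre (hW's hz₁) hz (Set.mk_mem_prod ht₀ (Set.mem_univ x₀))
    exact hx₀ (by simpa using h)

/-- ★ **Regular, or a passive scalar on an open dense part of the slab.**  Class binders of `stub_zShockThickAut` (Type-I rate,
continuity, Oseen identity, divergence-free, poloidal) + the stub's LOCAL autonomy clause on an open nonempty `W₁` of the backward slab.
Then EITHER the profile is not backward-singular at the apex (the horizontally flat stratum `∂₀v₂ ≡ 0`, settled by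
`…Flat.stub_flatStratum`), OR the non-degenerate set `{∂₀v₂ ≠ 0}` meets every nonempty open subset of the slab and at each of its points
the Clebsch weight `v₂ − G(t,v₂)` of a local `C^∞` slope antiderivative `G` is a passive scalar with a `(t, x₂)`-only source on a
space–time box (`clebschWeight_transport_of_class_autonomy`). [folklore] -/
theorem regular_or_dense_transport_of_class_autonomy (hrate : HasTypeITimeDecay C v)
    (hcont : ContinuousOn (uncurry v) (Iio (0 : ℝ) ×ˢ univ))
    (hmild : ∀ s t : ℝ, s < t → t < 0 → ∀ x,
      v t x = UnboundedOperators.heatExtension (v s) (t - s) x - oseenDuhamel 1 s v v t x)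
    (hdiv : ∀ t < 0, VectorCalculus.IsDivFree (v t))
    (hpol : ∀ s < 0, ∀ y, ⟪curl (v s) y, EuclideanSpace.single 2 1⟫_ℝ = 0)
    {W₁ : Set (ℝ × EuclideanSpace ℝ (Fin 3))} (hW₁ : IsOpen W₁) (hW₁s : W₁ ⊆ Set.Iio (0 : ℝ) ×ˢ Set.univ)
    (hW₁ne : W₁.Nonempty) {g : ℝ → ℝ → ℝ}
    (haut : ∀ z ∈ W₁, ∀ b : Fin 3, b ≠ 2 →
      fderiv ℝ (v z.1) z.2 (EuclideanSpace.single 2 1) b =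
        g z.1 (v z.1 z.2 2) * fderiv ℝ (v z.1) z.2 (EuclideanSpace.single b 1) 2) :
    ¬ IsBackwardSingularPoint v 0 ∨
    ((∀ W' : Set (ℝ × EuclideanSpace ℝ (Fin 3)), IsOpen W' → W'.Nonempty → W' ⊆ Set.Iio (0 : ℝ) ×ˢ Set.univ →
        ∃ z ∈ W', fderiv ℝ (v z.1) z.2 (EuclideanSpace.single 0 1) 2 ≠ 0) ∧
      ∀ z : ℝ × EuclideanSpace ℝ (Fin 3), z.1 < 0 → fderiv ℝ (v z.1) z.2 (EuclideanSpace.single 0 1) 2 ≠ 0 →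
        ∃ G : ℝ → ℝ → ℝ, ContDiff ℝ ∞ (uncurry G) ∧ ∃ A : ℝ → ℝ → ℝ, ∃ r > (0 : ℝ),
          Metric.ball z.1 r ×ˢ Metric.ball z.2 r ⊆ Set.Iio (0 : ℝ) ×ˢ Set.univ ∧
          (∀ z' ∈ Metric.ball z.1 r ×ˢ Metric.ball z.2 r, ∀ b : Fin 3, b ≠ 2 →
            fderiv ℝ (v z'.1) z'.2 (EuclideanSpace.single 2 1) b =
              deriv (G z'.1) (v z'.1 z'.2 2) * fderiv ℝ (v z'.1) z'.2 (EuclideanSpace.single b 1) 2) ∧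
          ∀ z' ∈ Metric.ball z.1 r ×ˢ Metric.ball z.2 r,
            deriv (fun s => v s z'.2 2 - G s (v s z'.2 2)) z'.1
                + fderiv ℝ (fun y => v z'.1 y 2 - G z'.1 (v z'.1 y 2)) z'.2 (v z'.1 z'.2)
                - Δ (fun y => v z'.1 y 2 - G z'.1 (v z'.1 y 2)) z'.2 = A z'.1 (z'.2 2)) := by
  rcases entry_zero_or_dense_ne hrate hcont hmild 0 2 with hflat | hdense
  · exact Or.inl (stub_flatStratum C v hrate hcont hmild hdiv hpol hflat)
  · refine Or.inr ⟨hdense, fun z hz1 hz => ?_⟩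
    exact clebschWeight_transport_of_class_autonomy hrate hcont hmild hdiv hpol hW₁ hW₁s hW₁ne haut hz1 (Or.inl hz)

end Summit.NavierStokesRegularity.NavierStokesRegularity.Theorems.PoloidalWindowDoorPoloidalWindowRigidityZShockSFDichotomy

end
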